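import Summits.ValiantsHypothesis.ValiantsHypothesis.Theorems.GrenetZeonDualUnipotentThreeHalvesHeavyTopCompositionBoundGeneral

/-!
# `GrenetZeon.DualUnipotentThreeHalves` (stmt-ValiantsHypothesis-24318), R2 heavy-top instrument — COROLLARY II port, step (c1):
# the THREE-LEVEL POSITION COUNT `C(m,2) = C(s₀,2) + C(s₁,2) + C(s₂,2) + #{(i,j) : lvl j < lvl i}`

Companion arithmetic of the three-level graded count ✓ `…HeavyTopCodimOneCount.finrank_le_of_three_levels`: for a level function
`lvl : Fin m → ℕ` with values `≤ 2` and level sizes `s_t = #{i : lvl i = t}`,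

* `card_fin_eq_three_levels` — `m = s₀ + s₁ + s₂`;
* `card_pattern_three_levels` — `#{(i, j) : lvl j < lvl i} = s₁ s₀ + s₂ s₀ + s₂ s₁`;
* ★ `choose_two_eq_three_levels` — `C(m, 2) = C(s₀, 2) + C(s₁, 2) + C(s₂, 2) + #{(i, j) : lvl j < lvl i}`,

so that «`dim V = C(m,2) − 1`» and the count turn into «the three block deficiencies `C(s_t,2) − dim W_t` sum to at most `1`» (crux note
`CENSUS-THMC-UNIFORM-eng1g5.md` §8, composition-chain route; deficiency table ✓ `…HeavyTopCodimOneBlocks`).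

Honest framing: counting; nothing here proves or refutes `HeavyTopLaw`, 24318, S3b or 8062; `VP ≠ VNP` is NOT proved.  No definitions.
[folklore; cell val-heavytop-census, eng-1 g5]
-/

noncomputable section

-- single-conjunct layout: Sub = Summit, duplicated namespace component intended
set_option linter.dupNamespace false

namespace Summit.ValiantsHypothesis.ValiantsHypothesis.Theorems.GrenetZeon.HeavyTopCodimOneArith

open Summit.ValiantsHypothesis.ValiantsHypothesis.Theorems.GrenetZeon.HeavyTopCompositionBound (add_choose_two)

/-- `m = s₀ + s₁ + s₂`. -/
theorem card_fin_eq_three_levels {m : ℕ} (lvl : Fin m → ℕ) (hlvl : ∀ i, lvl i ≤ 2) :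
    m = Fintype.card {i : Fin m // lvl i = 0} + Fintype.card {i : Fin m // lvl i = 1} + Fintype.card {i : Fin m // lvl i = 2} := by
  classical
  rw [Fintype.card_subtype, Fintype.card_subtype, Fintype.card_subtype]
  have hmaps : ((Finset.univ : Finset (Fin m)) : Set (Fin m)).MapsTo lvl (Finset.range 3 : Finset ℕ) := by
    intro i _
    rw [Finset.coe_range, Set.mem_Iio]
    have := hlvl i
    omega
  have h := Finset.card_eq_sum_card_fiberwise hmaps
  rw [Finset.card_univ, Fintype.card_fin, Finset.sum_range_succ, Finset.sum_range_succ, Finset.sum_range_one] at h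
  exact h

/-- The pairs with prescribed levels: `#{(i, j) : lvl i = t ∧ lvl j = t'} = s_t · s_{t'}`. -/
theorem card_pairs_levels {m : ℕ} (lvl : Fin m → ℕ) (t t' : ℕ) :
    (Finset.univ.filter fun x : Fin m × Fin m => lvl x.1 = t ∧ lvl x.2 = t').card =
      Fintype.card {i : Fin m // lvl i = t} * Fintype.card {i : Fin m // lvl i = t'} := by
  classical
  rw [Fintype.card_subtype, Fintype.card_subtype, ← Finset.card_product, ← Finset.filter_product, Finset.univ_product_univ]

/-- `#{(i, j) : lvl j < lvl i} = s₁ s₀ + s₂ s₀ + s₂ s₁` (levels `≤ 2`). -/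
theorem card_pattern_three_levels {m : ℕ} (lvl : Fin m → ℕ) (hlvl : ∀ i, lvl i ≤ 2) :
    Fintype.card {x : Fin m × Fin m // lvl x.2 < lvl x.1} =
      Fintype.card {i : Fin m // lvl i = 1} * Fintype.card {i : Fin m // lvl i = 0} +
        Fintype.card {i : Fin m // lvl i = 2} * Fintype.card {i : Fin m // lvl i = 0} +
        Fintype.card {i : Fin m // lvl i = 2} * Fintype.card {i : Fin m // lvl i = 1} := by
  classical
  rw [← card_pairs_levels, ← card_pairs_levels, ← card_pairs_levels, Fintype.card_subtype]
  have hsplit : (Finset.univ.filter fun x : Fin m × Fin m => lvl x.2 < lvl x.1) =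
      ((Finset.univ.filter fun x : Fin m × Fin m => lvl x.1 = 1 ∧ lvl x.2 = 0) ∪
        (Finset.univ.filter fun x : Fin m × Fin m => lvl x.1 = 2 ∧ lvl x.2 = 0)) ∪
        (Finset.univ.filter fun x : Fin m × Fin m => lvl x.1 = 2 ∧ lvl x.2 = 1) := by
    ext x
    simp only [Finset.mem_filter, Finset.mem_univ, true_and, Finset.mem_union]
    have h1 := hlvl x.1
    have h2 := hlvl x.2
    omega
  have hd1 : Disjoint (Finset.univ.filter fun x : Fin m × Fin m => lvl x.1 = 1 ∧ lvl x.2 = 0)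
      (Finset.univ.filter fun x : Fin m × Fin m => lvl x.1 = 2 ∧ lvl x.2 = 0) :=
    Finset.disjoint_filter.2 fun x _ h h' => by omega
  have hd2 : Disjoint ((Finset.univ.filter fun x : Fin m × Fin m => lvl x.1 = 1 ∧ lvl x.2 = 0) ∪
      (Finset.univ.filter fun x : Fin m × Fin m => lvl x.1 = 2 ∧ lvl x.2 = 0))
      (Finset.univ.filter fun x : Fin m × Fin m => lvl x.1 = 2 ∧ lvl x.2 = 1) := by
    rw [Finset.disjoint_union_left]
    exact ⟨Finset.disjoint_filter.2 fun x _ h h' => by omega, Finset.disjoint_filter.2 fun x _ h h' => by omega⟩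
  rw [hsplit, Finset.card_union_of_disjoint hd2, Finset.card_union_of_disjoint hd1]

/-- ★ **`C(m, 2) = C(s₀, 2) + C(s₁, 2) + C(s₂, 2) + #{(i, j) : lvl j < lvl i}`** (levels `≤ 2`). [folklore] -/
theorem choose_two_eq_three_levels {m : ℕ} (lvl : Fin m → ℕ) (hlvl : ∀ i, lvl i ≤ 2) :
    m.choose 2 = (Fintype.card {i : Fin m // lvl i = 0}).choose 2 + (Fintype.card {i : Fin m // lvl i = 1}).choose 2 +
      (Fintype.card {i : Fin m // lvl i = 2}).choose 2 + Fintype.card {x : Fin m × Fin m // lvl x.2 < lvl x.1} := by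
  rw [card_pattern_three_levels lvl hlvl]
  conv_lhs => rw [card_fin_eq_three_levels lvl hlvl]
  rw [add_choose_two, add_choose_two]
  ring

end Summit.ValiantsHypothesis.ValiantsHypothesis.Theorems.GrenetZeon.HeavyTopCodimOneArith

end
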